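import Mathlib
import HarnessLib

/-!
# Gambler's ruin: the first-step systems (2.3), (2.4) have the solutions `p_k = k/n`, `f_k = k(n−k)` (Levin–Peres–Wilmer Prop. 2.1)

HONEST FRAMING: exact (Metropolis-corrected) sampling algorithms for lattice gauge theory; figures
of merit are autocorrelation/cost numbers at stated couplings and volumes; no continuum-physics claim.

Source: D. A. Levin, Y. Peres (with E. L. Wilmer), *Markov Chains and Mixing Times*, 2nd ed., AMS
2017 [LevinPeres2017], §2.1 "Gambler's ruin", Prop. 2.1 with eqs. (2.1)–(2.4) and Exercise 2.1,
pp. 21–22.  Everything is PROVED (0 named facts, 0 definitions).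

The printed proof of Proposition 2.1 writes `p_k = P_k{X_τ = n}` and `f_k = E_k(τ)`, derives by
first-step analysis the linear systems
(2.3) `p_0 = 0`, `p_n = 1`, `p_k = ½p_{k−1} + ½p_{k+1}` (`1 ≤ k ≤ n−1`) and
(2.4) `f_0 = f_n = 0`, `f_k = ½(1 + f_{k+1}) + ½(1 + f_{k−1})` (`1 ≤ k ≤ n−1`),
and then SOLVES them: "Solving the system (2.3) of linear equations yields `p_k = k/n`"; "Exercise
2.1 asks the reader to solve this system of equations, completing the proof of (2.2)".  This file
formalises exactly that solving step — every solution of (2.3) is `k/n` and every solution of (2.4)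
is `k(n−k)` (second differences vanish, resp. equal `−2`, so `p`, resp. `f_k + k²`, is affine in `k`).

* `affine_of_second_diff_zero` — a function on `{0,…,n}` with vanishing second differences is
  affine, `h_k = h_0 + k(h_1 − h_0)` [cite: LevinPeres2017, §2.1, proof of Prop. 2.1 ("Solving the
  system (2.3)")];
* **PROP. 2.1, EQ. (2.1) via (2.3)** `LevinPeres2017_prop_2_1_eq_2_3` — `p_k = k/n`
  [cite: LevinPeres2017, §2.1 Prop. 2.1, eqs. (2.1), (2.3)];
* **PROP. 2.1, EQ. (2.2) via (2.4)** `LevinPeres2017_prop_2_1_eq_2_4` — `f_k = k(n − k)`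
  [cite: LevinPeres2017, §2.1 Prop. 2.1, eqs. (2.2), (2.4), Exercise 2.1].

NOT CLAIMED: the first-step analysis itself (that `P_k{X_τ = n}` and `E_k τ` satisfy (2.3), (2.4)),
which is a statement about the trajectory space of the walk.

Context (cell pub-lqcd, venture LatticeQCDFlow): `k(n−k) ≤ n²/4` is the diffusive exit time of a
window of width `n`, the elementary estimate behind "random-walk" autocorrelation heuristics for
local updates of a bounded observable.
-/

namespace Literature.Probability.MarkovChains

/-- A function on `{0,…,n}` whose second differences vanish on the interior,
`h_{k+1} − h_k = h_k − h_{k−1}` (`1 ≤ k ≤ n−1`), is affine: `h_k = h_0 + k(h_1 − h_0)`.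
[cite: LevinPeres2017, §2.1, proof of Prop. 2.1 ("Solving the system (2.3) of linear equations")] -/
theorem affine_of_second_diff_zero {h : ℕ → ℝ} {n : ℕ}
    (hh : ∀ k, 1 ≤ k → k + 1 ≤ n → h (k + 1) - h k = h k - h (k - 1)) :
    ∀ k, k ≤ n → h k = h 0 + k * (h 1 - h 0) := by
  intro k
  induction k using Nat.strong_induction_on with
  | _ k ih =>
    intro hk
    rcases k with _ | _ | k
    · simp
    · push_cast
      ring
    · have e0 := ih k (by omega) (by omega)
      have e1 := ih (k + 1) (by omega) (by omega)
      have hs := hh (k + 1) (by omega) (by omega)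
      simp only [Nat.add_sub_cancel] at hs
      push_cast at e0 e1 ⊢
      linarith

/-- **PROPOSITION 2.1, EQ. (2.1) via the system (2.3)**: if `p_0 = 0`, `p_n = 1` and
`p_k = ½p_{k−1} + ½p_{k+1}` for `1 ≤ k ≤ n − 1`, then **`p_k = k/n`** for `0 ≤ k ≤ n` ("Solving the
system (2.3) of linear equations yields `p_k = k/n`"; in the book `p_k = P_k{X_τ = n}`, the
probability of reaching `n` before ruin). [cite: LevinPeres2017, §2.1 Prop. 2.1, eqs. (2.1), (2.3)] -/
theorem LevinPeres2017_prop_2_1_eq_2_3 {n : ℕ} {p : ℕ → ℝ} (hp0 : p 0 = 0) (hpn : p n = 1)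
    (hh : ∀ k, 1 ≤ k → k + 1 ≤ n → p k = 1 / 2 * p (k - 1) + 1 / 2 * p (k + 1)) :
    ∀ k, k ≤ n → p k = k / n := by
  have hn : n ≠ 0 := by
    rintro rfl
    rw [hp0] at hpn
    exact zero_ne_one hpn
  have hn' : (n : ℝ) ≠ 0 := by exact_mod_cast hn
  have haff := affine_of_second_diff_zero (h := p) (n := n) fun k hk hkn => by
    have := hh k hk hkn
    linarith
  have hd : p 1 - p 0 = 1 / n := by
    have h1 := haff n le_rfl
    rw [hpn, hp0] at h1
    rw [hp0, sub_zero, eq_div_iff hn']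
    linarith
  intro k hk
  rw [haff k hk, hd, hp0, zero_add, mul_one_div]

/-- **PROPOSITION 2.1, EQ. (2.2) via the system (2.4)**: if `f_0 = f_n = 0` and
`f_k = ½(1 + f_{k+1}) + ½(1 + f_{k−1})` for `1 ≤ k ≤ n − 1`, then **`f_k = k(n − k)`** for
`0 ≤ k ≤ n` (Exercise 2.1; in the book `f_k = E_k(τ)`, the expected absorption time): `f_k + k²`
has vanishing second differences. [cite: LevinPeres2017, §2.1 Prop. 2.1, eqs. (2.2), (2.4),
Exercise 2.1] -/
theorem LevinPeres2017_prop_2_1_eq_2_4 {n : ℕ} {f : ℕ → ℝ} (hf0 : f 0 = 0) (hfn : f n = 0)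
    (hh : ∀ k, 1 ≤ k → k + 1 ≤ n → f k = 1 / 2 * (1 + f (k + 1)) + 1 / 2 * (1 + f (k - 1))) :
    ∀ k, k ≤ n → f k = k * (n - k) := by
  intro k hk
  rcases Nat.eq_zero_or_pos n with rfl | hn
  · obtain rfl : k = 0 := by omega
    simp [hf0]
  have hn' : (n : ℝ) ≠ 0 := by exact_mod_cast hn.ne'
  -- `g_k = f_k + k²` is affine
  have haff := affine_of_second_diff_zero (h := fun k => f k + (k : ℝ) ^ 2) (n := n)
    fun k hk1 hkn => by
      show f (k + 1) + ((k + 1 : ℕ) : ℝ) ^ 2 - (f k + (k : ℝ) ^ 2) =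
        f k + (k : ℝ) ^ 2 - (f (k - 1) + ((k - 1 : ℕ) : ℝ) ^ 2)
      rw [Nat.cast_sub hk1]
      push_cast
      have := hh k hk1 hkn
      linarith
  have hgn := haff n le_rfl
  have hgk := haff k hk
  beta_reduce at hgn hgk
  push_cast at hgn hgk
  rw [hfn, hf0] at hgn
  rw [hf0] at hgk
  -- from `n² = n(f_1 + 1)`: `f_1 + 1 = n`
  have hd : f 1 + 1 = n := by
    apply mul_left_cancel₀ hn'
    linear_combination -hgn
  linear_combination hgk + (k : ℝ) * hd

end Literature.Probability.MarkovChains
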